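import Literature.Geometry.Kaehler.ComplexTorus
import Mathlib.Geometry.Manifold.MFDeriv.Basic
import Mathlib.Geometry.Manifold.IsManifold.Basic
import HarnessLib

/-!
# Relative exponential charts: the quotient-free currency for ANALYTIC FAMILIES OF COMPLEX TORI
# ([BirkenhakeLange2004] §1.1 and Ch. 8; [Shimura1963AnalyticFamilies] §2; [MumfordFogartyKirwan1994] App. 7A)

Layer `Literature/Geometry/ComplexAnalytic`, namespace `Literature.Geometry.ComplexAnalytic`.  ONE `Prop`-valued structure + proved API (no
named fact, no instance, no notation, no `sorry`).  Cell `hodgecm-mathlib` (D-0151), FLOOR 0, P6 «MOD» (crux hLiu418 = stmt-HodgeConjecture-24832,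
`--supports`), LEAD F0P6-plan (g2) RULING M-17m″ (2026-09-01T21:47:49Z) «(I-1) FAMILY ANALYTIFICATION ∕ KUGA TYPING»: the shared currency of the three
organs U6-a `RelativeExponentialUniformisation` (A-p02: the analytification of an abelian scheme `A → S` over `ℂ` carries such charts locally on
`S^an`), U6-b `MarkedFamilyHomCriterion` (A-p06: a fibrewise-linear map which is `ℂ`-linear on every fibre and integral on the lattices IS a
holomorphic map of families), U6-c `SiegelUniversalFamilyPeriods` (A-p12: the charts of the universal family over the Siegel pieces have the
tautological period family `Z ↦ (Z, δ)`), and of the E6 closer of `Cruxes/HLiu418/Lines/F0_P6a_PELWitnessE.lean` (`stub_E6`).  Named by the E6 owner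
A-p06 (g32) on A-p02 (g20)'s quotient-free proposal (census `CENSUS-U6a-…v1` §0.5).  HC_CM is proved only modulo the printed citations until rung 0
closes; this file is generic and changes no count.

THE MATHEMATICS.  An analytic family of complex tori over a complex manifold `B` is, in print, `M = Lie ∕ R₁ → B` with `Lie` a holomorphic vector
bundle and `R₁ ⊂ Lie` a local system of full lattices; the exponential `exp : Lie → M` is a surjective étale holomorphic map over `B` with kernel `R₁`
([BirkenhakeLange2004] §1.1 for one torus, Ch. 8 for the families over `𝔥_g`; [Shimura1963AnalyticFamilies] §2).  Over an open `U ⊆ B` where `Lie` and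
`R₁` are trivialised this is EXACTLY the data recorded here, with no quotient and no sub-manifold types: a holomorphic PERIOD FAMILY
`Φ : B → ((ι → ℝ) ≃L[ℝ] E)` (`R₁|_U = Φ(ℤ^ι)`, `Lie|_U = U × E`) and a map `ex : B × E → M` holomorphic on `U × E`, over `p : M → B`, onto each fibre
over `U`, with kernel exactly `Φ b (ℤ^ι)`, and ÉTALE (local homeomorphisms onto opens of `M` with holomorphic inverses — the local sections through
which holomorphy of maps OUT of `M` is tested, U6-b).  The fibre over `b ∈ U` is the ★ complex torus `ComplexTorus (Φ b)` through `ex (b, ·)`; nothing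
single-torus is restated here.  The model spaces `EB` (base) and `EM` (total space) are explicit arguments, as for Mathlib's `MDifferentiable I I′`.

* `IsRelExpChartOn EB EM p U Φ ex` — the structure (7 fields); `IsRelExpChartOn.mono` (restriction to a smaller open), `range_ex_eq` (the image of
  `ex (b, ·)` is the fibre), `ex_add_period` (periods are in the kernel), `exists_int_of_ex_eq` (the kernel is the lattice).

## References
* [BirkenhakeLange2004] C. Birkenhake, H. Lange, *Complex Abelian Varieties*, 2nd ed. (2004), §1.1 (complex tori, `π : V → X`); Ch. 8 (moduli, families over `𝔥_g`).
* [Shimura1963AnalyticFamilies] G. Shimura, *On analytic families of polarized abelian varieties and automorphic functions*, Ann. Math. 78 (1963), §2.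
* [MumfordFogartyKirwan1994] D. Mumford, J. Fogarty, F. Kirwan, *Geometric Invariant Theory*, 3rd ed., Appendix 7A (pp. 234–235).
-/

set_option autoImplicit false

noncomputable section

open scoped Manifold

namespace Literature.Geometry.ComplexAnalytic

variable (EB : Type*) [NormedAddCommGroup EB] [NormedSpace ℂ EB] {B : Type*} [TopologicalSpace B] [ChartedSpace EB B]
  {E : Type*} [NormedAddCommGroup E] [NormedSpace ℂ E] {ι : Type*}
  (EM : Type*) [NormedAddCommGroup EM] [NormedSpace ℂ EM] {M : Type*} [TopologicalSpace M] [ChartedSpace EM M]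

/-- **`IsRelExpChartOn EB EM p U Φ ex` — a RELATIVE EXPONENTIAL CHART of the family `p : M → B` over the open `U ⊆ B`**: a holomorphic period family
`Φ b : (ι → ℝ) ≃L[ℝ] E` (`b ↦ Φ b x` holomorphic on `U` for every `x`) and a map `ex : B × E → M`, holomorphic on `U × E`, lying over `p`
(`p (ex (b, z)) = b`), onto every fibre `p⁻¹ b`, `b ∈ U`, with kernel EXACTLY the lattice `Φ b (ℤ^ι)`, and étale: every point of `U × E` has a
neighbourhood on which `ex` restricts to a homeomorphism onto an open of `M` WITH HOLOMORPHIC INVERSE.  In print: `exp : Lie(A∕S)|_U = U × ℂ^g → A^an|_U`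
with kernel `R₁f_*ℤ|_U = Φ(ℤ^{2g})` trivialised ([DeligneHodgeII1971] §4.4 (4.4.2)–(4.4.3); [BirkenhakeLange2004] §1.1 and Ch. 8).  The fibre over `b ∈ U` is the ★
complex torus `ComplexTorus (Φ b)` through `ex (b, ·)`; nothing single-torus is restated.  The model spaces `EB` (of the base) and `EM` (of the
total space) are explicit, as for Mathlib's `MDifferentiable I I'`.  A `Prop`-valued carrier; nothing is asserted by declaring it.
[cite: BirkenhakeLange2004, §1.1 (complex tori `X = V/Λ` and the projection `π : V → X`)] [cite: Shimura1963AnalyticFamilies, §2] [cite: MumfordFogartyKirwan1994, Appendix 7A (pp. 234–235)] -/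
structure IsRelExpChartOn (p : M → B) (U : Set B) (Φ : B → ((ι → ℝ) ≃L[ℝ] E)) (ex : B × E → M) : Prop where
  /-- `U` is open. -/
  isOpen : IsOpen U
  /-- the period family is holomorphic on `U`: `b ↦ Φ b x` for every real vector `x`. -/
  mdifferentiableOn_period : ∀ x : ι → ℝ, MDifferentiableOn 𝓘(ℂ, EB) 𝓘(ℂ, E) (fun b => Φ b x) U
  /-- `ex` is holomorphic on `U × E`. -/
  mdifferentiableOn_ex : MDifferentiableOn (𝓘(ℂ, EB).prod 𝓘(ℂ, E)) 𝓘(ℂ, EM) ex (U ×ˢ Set.univ)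
  /-- `ex` lies over `p` on `U × E`. -/
  p_ex : ∀ b ∈ U, ∀ z : E, p (ex (b, z)) = b
  /-- `ex (b, ·)` is onto the fibre `p⁻¹ b` for `b ∈ U`. -/
  ex_surj : ∀ m : M, p m ∈ U → ∃ z : E, ex (p m, z) = m
  /-- the kernel of `ex (b, ·)` is exactly the lattice `Φ b (ℤ^ι)`. -/
  ex_eq_ex_iff : ∀ b ∈ U, ∀ z z' : E, ex (b, z) = ex (b, z') ↔ ∃ n : ι → ℤ, z' = z + Φ b (fun i => (n i : ℝ))
  /-- `ex` is étale on `U × E`: local homeomorphisms onto opens of `M` with HOLOMORPHIC inverses. -/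
  exists_localInverse : ∀ x ∈ U ×ˢ (Set.univ : Set E), ∃ e : OpenPartialHomeomorph (B × E) M,
    x ∈ e.source ∧ e.source ⊆ U ×ˢ Set.univ ∧ (∀ y ∈ e.source, e y = ex y) ∧
      MDifferentiableOn 𝓘(ℂ, EM) (𝓘(ℂ, EB).prod 𝓘(ℂ, E)) e.symm e.target

namespace IsRelExpChartOn

variable {EB EM} {p : M → B} {U : Set B} {Φ : B → ((ι → ℝ) ≃L[ℝ] E)} {ex : B × E → M}

/-- `ex` restricted to a smaller open of the base is still a relative exponential chart. [cite: BirkenhakeLange2004, §1.1] -/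
theorem mono (h : IsRelExpChartOn EB EM p U Φ ex) {V : Set B} (hV : IsOpen V) (hVU : V ⊆ U) :
    IsRelExpChartOn EB EM p V Φ ex where
  isOpen := hV
  mdifferentiableOn_period x := (h.mdifferentiableOn_period x).mono hVU
  mdifferentiableOn_ex := h.mdifferentiableOn_ex.mono (Set.prod_mono hVU le_rfl)
  p_ex b hb z := h.p_ex b (hVU hb) z
  ex_surj m hm := h.ex_surj m (hVU hm)
  ex_eq_ex_iff b hb z z' := h.ex_eq_ex_iff b (hVU hb) z z'
  exists_localInverse x hx := by
    obtain ⟨e, hxe, hsrc, heq, hd⟩ := h.exists_localInverse x ⟨hVU hx.1, hx.2⟩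
    refine ⟨e.restrOpen (V ×ˢ Set.univ) (hV.prod isOpen_univ), ?_, ?_, ?_, ?_⟩
    · exact ⟨hxe, hx⟩
    · intro y hy
      exact hy.2
    · intro y hy
      exact heq y hy.1
    · exact hd.mono fun m hm => hm.1

/-- The image of `ex (b, ·)`, `b ∈ U`, is the whole fibre `p⁻¹ b` («`π : V → X` is surjective»). [cite: BirkenhakeLange2004, §1.1] -/
theorem range_ex_eq (h : IsRelExpChartOn EB EM p U Φ ex) {b : B} (hb : b ∈ U) :
    Set.range (fun z : E => ex (b, z)) = p ⁻¹' {b} := by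
  ext m
  constructor
  · rintro ⟨z, rfl⟩
    exact h.p_ex b hb z
  · intro hm
    have hpm : p m = b := hm
    obtain ⟨z, hz⟩ := h.ex_surj m (hpm ▸ hb)
    exact ⟨z, by rw [← hpm]; exact hz⟩

/-- Periods are in the kernel: `ex (b, z + Φ b n) = ex (b, z)` for `n ∈ ℤ^ι`. [cite: BirkenhakeLange2004, §1.1] -/
theorem ex_add_period (h : IsRelExpChartOn EB EM p U Φ ex) {b : B} (hb : b ∈ U) (z : E) (n : ι → ℤ) :
    ex (b, z + Φ b (fun i => (n i : ℝ))) = ex (b, z) :=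
  ((h.ex_eq_ex_iff b hb z _).2 ⟨n, rfl⟩).symm

/-- The kernel is the lattice: `ex (b, z) = ex (b, z′)` forces `z′ - z ∈ Φ b (ℤ^ι)`. [cite: BirkenhakeLange2004, §1.1] -/
theorem exists_int_of_ex_eq (h : IsRelExpChartOn EB EM p U Φ ex) {b : B} (hb : b ∈ U) {z z' : E} (hzz' : ex (b, z) = ex (b, z')) :
    ∃ n : ι → ℤ, z' = z + Φ b (fun i => (n i : ℝ)) :=
  (h.ex_eq_ex_iff b hb z z').1 hzz'

end IsRelExpChartOn

end Literature.Geometry.ComplexAnalytic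

end
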